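import Summits.BirchSwinnertonDyer.BirchSwinnertonDyer.Theorems.GenusKolyvaginAtTwoCasselsTatePTcRealReadout
import HarnessLib

/-!
# The COUPLED Cassels–Tate telescope, XVIII: the THIN CONE FILE — the displayed inputs `H3` and `LP`
# of `tailFour_of_residue` / `tailSeven_of_residue` are THEOREMS (planner D590/D635 (R6): the only
# K7t file importing route GenusKolyvaginAtTwo's Cassels–Tate cone)

Crux `UpperOffV0HSYPlus` (stmt-BirchSwinnertonDyer-19804).  `…CoupledTelescopeTailFourOfResidue` /
`…TailSevenOfResidue` display `H3` (`Ш³(F, μ_n) = 0` for every number field) and `LP` (the LEVEL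
property of Milne's recipe on the canonical invariant family, fully quantified, the `Ш³ = 0` proof a
bound variable) as hypotheses, to keep those files off the ≈ 1 700-module import cone of route
GenusKolyvaginAtTwo.  Here both are discharged BY NAME from that cone:
`H3_holds := GenusExact.VisiblePairAtTwo.shaThree_mu_eq_zero` (Milne ADT I Thm. 4.10 (c), tree theorem) and
`LP_holds := GenusExact.CasselsTatePTcReal.isLevelPairing_ctLevelPairing_canonical_of_alt`
(Milne ADT I §6 Prop. 6.9 / Thm. 6.13 (a) / Lemma 6.15 for THE canonical maps; tree theorem; the two
statements differ only in the proof-irrelevant `Ш³ = 0` argument).  After this file: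
`stub_tailFour ⟸ {VII, RESIDUE 4}`, `stub_tailSeven ⟸ {VII, RESIDUE 7}` by
`tailFour_of_residue hvii H3_holds LP_holds hR`.  Theorem-only; nothing asserted on 19804; no stub
closed; X12.CMAtTwo NOT proved; BSD not claimed for any curve.
-/

-- every Summits module is named `Summit.<Summit>.<Problem>…`: the duplicated component is by design
set_option linter.dupNamespace false
set_option autoImplicit false

noncomputable section

open scoped Classical

open WeierstrassCurve Literature.NumberTheory.EllipticCurves Field NumberField
  Literature.NumberTheory.GaloisRepresentations Literature.NumberTheory.GaloisCohomology
  Literature.GroupTheory.FiniteAbelian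
open Literature.NumberTheory.GaloisRepresentations.DiscreteGaloisModule (mu)

namespace Summit.BirchSwinnertonDyer.BirchSwinnertonDyer.Theorems.SylvesterTwoCoupledTelescope

/-- **`H3` holds**: `Ш³(F, μ_n) = 0` for every number field `F` and every level `n` (the cone's
`VisiblePairAtTwo.shaThree_mu_eq_zero`). [cite: MilneADT2006, Ch. I, Thm. 4.10 (c)] -/
theorem H3_holds : ∀ (F : Type) [Field F] [NumberField F] (n : ℕ) [NeZero n]
    (c : galoisCohomology (mu F n) 3),
    (∀ v : Place F, galoisCohomology.localization (mu F n) v 3 c = 0) → c = 0 :=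
  fun F _ _ n _ ↦ GenusExact.VisiblePairAtTwo.shaThree_mu_eq_zero F n

/-- **`LP` holds**: the Cassels–Tate pairing of THE canonical invariant maps at any prime-power level
`p^k` (`k ≥ 1`), over any number field, for any elliptic curve and any non-degenerate alternating
Weil datum, is a LEVEL pairing as soon as its general-case value is alternating on `Ш[p^k]` — the
cone's `isLevelPairing_ctLevelPairing_canonical_of_alt`, restated with the `Ш³ = 0` input a bound
variable (proof-irrelevant). [cite: MilneADT2006, Ch. I §6 Prop. 6.9, Thm. 6.13 (a), Lemma 6.15] -/
theorem LP_holds : ∀ (K : Type) [Field K] [NumberField K] (W : WeierstrassCurve K) [W.IsElliptic] (p k : ℕ)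
    [Fact p.Prime]
    (e : geomTorsion W ((p ^ k * p ^ k : ℕ) : ℤ) → geomTorsion W ((p ^ k * p ^ k : ℕ) : ℤ) →
      AlgebraicClosure K)
    (hμ : ∀ S T, e S T ^ (p ^ k * p ^ k) = 1)
    (hadd₁ : ∀ S₁ S₂ T, e (S₁ + S₂) T = e S₁ T * e S₂ T)
    (hadd₂ : ∀ S T₁ T₂, e S (T₁ + T₂) = e S T₁ * e S T₂)
    (hgal : ∀ (σ : absoluteGaloisGroup K) (S T : geomTorsion W ((p ^ k * p ^ k : ℕ) : ℤ)),
      σ • e S T = e (σ • S) (σ • T))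
    (halt : ∀ T, e T T = 1) (hnd : ∀ T, (∀ S, e S T = 1) → T = 0)
    [NeZero (p ^ k)] [NeZero (p ^ k * p ^ k)], 0 < k →
    (∀ a ∈ W.sha, ((p ^ k : ℕ) : ℤ) • a = 0 →
      ctGeneralFun W (p ^ k) e hμ hadd₁ hadd₂ hgal (LocalInvariants.canonical K (p ^ k * p ^ k)) a a = 0) →
    ∀ (hH3' : ∀ c : galoisCohomology (mu K (p ^ k * p ^ k)) 3,
      (∀ v : Place K, galoisCohomology.localization (mu K (p ^ k * p ^ k)) v 3 c = 0) → c = 0),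
    IsLevelPairing (p ^ k)
      (ctLevelPairing W (p ^ k) e hμ hadd₁ hadd₂ hgal (LocalInvariants.canonical K (p ^ k * p ^ k)) halt
        (sumInvLocalizationEqZero_canonical_of_numberField K (p ^ k * p ^ k)) hH3'
        (localTerm_finite_support W (p ^ k) e hμ hadd₁ hadd₂ hgal halt
          (LocalInvariants.canonical K (p ^ k * p ^ k)))) :=
  fun _ _ _ W _ p k _ e hμ hadd₁ hadd₂ hgal halt hnd _ _ hk hct_alt _ ↦
    GenusExact.CasselsTatePTcReal.isLevelPairing_ctLevelPairing_canonical_of_alt W p k e hμ hadd₁ hadd₂ hgal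
      halt hnd hk hct_alt

end Summit.BirchSwinnertonDyer.BirchSwinnertonDyer.Theorems.SylvesterTwoCoupledTelescope

end
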